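import Summits.Ventures.HSemireg.EmbeddedFirstOrderDeformationsCechMinusOneRigid

/-!
# Venture HSemireg — the trivial bundle `ℙ¹ × 𝔸¹`: the zero section LIFTS along the shear, but NOT uniquely
# (`H¹(ℙ¹, 𝒪) = 0`, `H⁰(ℙ¹, 𝒪) = k ≠ 0`) — the third rung of the ladder `𝒪(0)` / `𝒪(−1)` / `𝒪(−2)`

HONEST FRAMING.  Lean side of the computation cell `pub-hsemireg` (track «S4-PUSH» (ii), seat s4-prove-3 g6, second
route for (S5)); log `s4push/prove-3/ATTEMPT-10.md` §5i.  Same charts, overlap and twist `θ = s⁻¹∂/∂p` as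
`…CechMinusTwoCurve` (no lift), `…CechMinusOneCurve`/`…Rigid` (unique lift); now the gluing is `t = s⁻¹`, `q = p`
(`X = ℙ¹ × 𝔸¹`, `Z = ℙ¹ × 0`, normal bundle `𝒪`): the zero section lifts (`φ₀ = 0`, `φ₁ = (q ↦ t)`), and the lifts
form a NON-trivial torsor — the constant normal field `1` is a non-zero compatible family, so translating a lift by
it gives a DIFFERENT lift.  Plain commutative algebra; no Mathlib scheme, sheaf, abelian variety or semiregularity
map; nothing here says that HC, HC_CM or HC_AV holds; no object is certified; no Literature fact is declared.

WHAT (namespace `Summit.Ventures.HSemireg.EmbeddedDeformation.DoubledLine`):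
* §2 `psi0` (`s ↦ s⁻¹`, `p ↦ p`), `resM0`, `preservesLifts_resM0`, `thickenedAtlas_trivialBundle`;
* §3 `tNormal = s·unitNormal` (the normal field `q ↦ t` read on chart 1), **`exists_isAtlasLift_trivialBundle`**;
* §4 `one_not_mem_idealZ`, `unitNormal_compatible` (the constant field `1` is a Čech `0`-cocycle),
  **`exists_ne_isAtlasLift_trivialBundle`** — two DIFFERENT lifts (`K` and `K + 1`, told apart by
  `…CechObstruction`'s `IsAtlasLift.diff_cocycle`/`diff_translate`).
Ladder (all for the same twist `s⁻¹∂/∂p`): `𝒪(0)`: lifts, not unique · `𝒪(−1)`: lifts uniquely · `𝒪(−2)`: no lift —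
exactly `(h⁰, h¹) = (1, 0), (0, 0), (0, 1)` of `𝒪(n)` on `ℙ¹` as Thm. 6.2 (b) predicts.

References: R. Hartshorne, *Deformation Theory*, GTM 257 (2010), §6 Thm. 6.2 (b) [corpus:
book:springernd-deformation-theory p0054].
-/

namespace Summit.Ventures.HSemireg

namespace EmbeddedDeformation

namespace DoubledLine

open DualNumber TrivSqZeroExt MvPolynomial

universe u

variable (k : Type u) [CommRing k]

/-! ### §2 The coordinate change `s ↦ s⁻¹, p ↦ p` of `ℙ¹ × 𝔸¹` and its atlas -/

/-- `k[s,p] → k[s,s⁻¹,p]`, `s ↦ s⁻¹`, `p ↦ p` (second chart of `ℙ¹ × 𝔸¹ = 𝒪_{ℙ¹}`: `t = s⁻¹`, `q = p`). -/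
noncomputable def psi0₀ : A k →+* L k :=
  (MvPolynomial.aeval ![IsLocalization.Away.invSelf (X 0 : A k), algebraMap (A k) (L k) (X 1)]).toRingHom

/-- `psi0₀ s = s⁻¹`. [folklore] -/
theorem psi0₀_X_zero : psi0₀ k (X 0) = IsLocalization.Away.invSelf (X 0 : A k) := by
  rw [psi0₀, AlgHom.toRingHom_eq_coe, AlgHom.coe_toRingHom, MvPolynomial.aeval_X]; rfl

/-- `psi0₀ p = p`. [folklore] -/
theorem psi0₀_X_one : psi0₀ k (X 1) = algebraMap (A k) (L k) (X 1) := by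
  rw [psi0₀, AlgHom.toRingHom_eq_coe, AlgHom.coe_toRingHom, MvPolynomial.aeval_X]; rfl

/-- `psi0₀` on constants. [folklore] -/
theorem psi0₀_C (c : k) : psi0₀ k (C c) = algebraMap (A k) (L k) (C c) := by
  rw [psi0₀, AlgHom.toRingHom_eq_coe, AlgHom.coe_toRingHom, MvPolynomial.algHom_C, ← MvPolynomial.algebraMap_eq]
  exact IsScalarTower.algebraMap_apply k (A k) (L k) c

/-- `psi0₀ s` is a unit. [folklore] -/
theorem isUnit_psi0₀_X_zero : IsUnit (psi0₀ k (X 0)) := by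
  rw [psi0₀_X_zero]
  exact IsUnit.of_mul_eq_one_right _ (IsLocalization.Away.mul_invSelf (S := L k) (X 0 : A k))

/-- The coordinate change extended to `L`. [folklore] -/
noncomputable def psi0Hom : L k →+* L k :=
  IsLocalization.Away.lift (X 0 : A k) (isUnit_psi0₀_X_zero k)

/-- `psi0Hom (a/1) = psi0₀ a`. [folklore] -/
theorem psi0Hom_algebraMap (a : A k) : psi0Hom k (algebraMap (A k) (L k) a) = psi0₀ k a :=
  IsLocalization.Away.lift_eq (X 0 : A k) (isUnit_psi0₀_X_zero k) a

/-- `psi0Hom (s⁻¹) = s`. [folklore] -/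
theorem psi0Hom_invSelf : psi0Hom k (IsLocalization.Away.invSelf (X 0 : A k)) = algebraMap (A k) (L k) (X 0) := by
  have h1 : psi0Hom k (algebraMap (A k) (L k) (X 0)) * psi0Hom k (IsLocalization.Away.invSelf (X 0 : A k)) = 1 := by
    rw [← map_mul, IsLocalization.Away.mul_invSelf, map_one]
  rw [psi0Hom_algebraMap, psi0₀_X_zero] at h1
  have h2 : IsLocalization.Away.invSelf (X 0 : A k) * algebraMap (A k) (L k) (X 0) = 1 := by
    rw [mul_comm, IsLocalization.Away.mul_invSelf]
  calc psi0Hom k (IsLocalization.Away.invSelf (X 0 : A k))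
      = (IsLocalization.Away.invSelf (X 0 : A k) * algebraMap (A k) (L k) (X 0)) *
          psi0Hom k (IsLocalization.Away.invSelf (X 0 : A k)) := by rw [h2, one_mul]
    _ = algebraMap (A k) (L k) (X 0) *
          (IsLocalization.Away.invSelf (X 0 : A k) * psi0Hom k (IsLocalization.Away.invSelf (X 0 : A k))) := by ring
    _ = algebraMap (A k) (L k) (X 0) := by rw [h1, mul_one]

/-- `psi0Hom` is an involution. [folklore] -/
theorem psi0Hom_comp_psi0Hom : (psi0Hom k).comp (psi0Hom k) = RingHom.id (L k) := by
  refine IsLocalization.ringHom_ext (Submonoid.powers (X 0 : A k)) ?_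
  refine MvPolynomial.ringHom_ext (fun c ↦ ?_) (fun i ↦ ?_)
  · simp only [RingHom.comp_apply, RingHom.id_apply, ← MvPolynomial.algebraMap_eq]
    rw [MvPolynomial.algebraMap_eq, psi0Hom_algebraMap, psi0₀_C, psi0Hom_algebraMap, psi0₀_C]
  · simp only [RingHom.comp_apply, RingHom.id_apply]
    fin_cases i
    · simp only [Fin.zero_eta, psi0Hom_algebraMap, psi0₀_X_zero, psi0Hom_invSelf]
    · simp only [Fin.mk_one, psi0Hom_algebraMap, psi0₀_X_one]

/-- The coordinate change as a ring automorphism (an involution). [folklore] -/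
noncomputable def psi0 : L k ≃+* L k :=
  RingEquiv.ofRingHom (psi0Hom k) (psi0Hom k) (psi0Hom_comp_psi0Hom k) (psi0Hom_comp_psi0Hom k)

/-- The chart maps of `ℙ¹ × 𝔸¹` into the overlap. -/
noncomputable def resM0 : Fin 2 → (A k →+* L k) :=
  ![algebraMap (A k) (L k), (psi0 k : L k →+* L k).comp (algebraMap (A k) (L k))]

/-- `resM0 1 = psi0 ∘` localisation. -/
theorem resM0_one : resM0 k 1 = (psi0 k : L k →+* L k).comp (algebraMap (A k) (L k)) := rfl

/-- `resM0 1 a = psi0Hom (a/1)`. -/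
theorem resM0_one_apply (a : A k) : resM0 k 1 a = psi0Hom k (algebraMap (A k) (L k) a) := rfl

/-- `resM0 1 (p) = p`. [folklore] -/
theorem resM0_one_X_one : resM0 k 1 (X 1) = algebraMap (A k) (L k) (X 1) := by
  rw [resM0_one_apply, psi0Hom_algebraMap, psi0₀_X_one]

/-- `(p)·L` is `psi0`-stable (`psi0` fixes `p`). [folklore] -/
theorem map_psi0_idealZ₂ (α β : Fin 2) : (idealZ₂ k α β).map (psi0 k : L k →+* L k) = idealZ₂ k α β := by
  change ((Ideal.span {(X 1 : A k)}).map _).map _ = (Ideal.span {(X 1 : A k)}).map _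
  rw [Ideal.map_map, Ideal.map_span, Ideal.map_span, Set.image_singleton, Set.image_singleton, RingHom.comp_apply]
  change Ideal.span {psi0Hom k _} = _
  rw [psi0Hom_algebraMap, psi0₀_X_one]

/-- Both chart maps carry flat lifts (as in `…CechMinusTwoCurve` / `…CechMinusOneCurve`). [folklore] -/
theorem preservesLifts_resM0 : ∀ α β : Fin 2,
    PreservesLifts (fstRingHom (A k)) (ε : (A k)[ε]) (fstRingHom (L k)) (ε : (L k)[ε]) (mapRingHom (resM0 k α))
      (idealZ k α) (idealZ₂ k α β) := by
  intro α β
  fin_cases α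
  · exact preservesLifts_mapRingHom_of_isLocalization (Submonoid.powers (X 0 : A k)) _
  · show PreservesLifts _ _ _ _ (mapRingHom (resM0 k 1)) (idealZ k 1) (idealZ₂ k 1 β)
    rw [resM0_one, mapRingHom_comp', ← coe_mapRingEquiv]
    intro K hK
    have h1 := preservesLifts_mapRingHom_of_isLocalization (S := L k) (Submonoid.powers (X 0 : A k)) (idealZ k 1) hK
    have h2 := h1.map_ringEquivPair (τ := fstRingHom (L k)) (e' := (ε : (L k)[ε])) (mapRingEquiv (psi0 k)) (psi0 k)
      (fun z ↦ by
        show (mapRingHom (psi0 k : L k →+* L k) z).fst = psi0 k z.fst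
        exact fst_mapRingHom _ z)
      (by
        show mapRingHom (psi0 k : L k →+* L k) ε = ε
        exact mapRingHom_eps _)
    rw [Ideal.map_map, Ideal.map_map] at h2
    have h3 : (idealZ k 1).map ((psi0 k : L k →+* L k).comp (algebraMap (A k) (L k))) = idealZ₂ k 1 β := by
      rw [← Ideal.map_map]
      exact map_psi0_idealZ₂ k 1 β
    rw [h3] at h2
    exact h2

/-- **`ℙ¹ × 𝔸¹` with the same shear IS a thickened atlas.** [folklore] -/
theorem thickenedAtlas_trivialBundle :
    ThickenedAtlas (fun _ : Fin 2 ↦ fstRingHom (A k)) (fun _ ↦ (ε : (A k)[ε])) (fun _ _ ↦ fstRingHom (L k))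
      (fun _ _ ↦ (ε : (L k)[ε])) (fun α _ ↦ mapRingHom (resM0 k α)) (fun α _ ↦ resM0 k α)
      (fun α β ↦ (twist (thetaFamily k α β) : (L k)[ε] →+* (L k)[ε]).comp (mapRingHom (resM0 k β)))
      (fun _ β ↦ resM0 k β) (idealZ k) (idealZ₂ k) :=
  thickenedAtlas_twisted (fun α _ ↦ resM0 k α) (fun _ β ↦ resM0 k β) (idealZ k) (idealZ₂ k) (thetaFamily k)
    (preservesLifts_resM0 k) (fun α β ↦ preservesLifts_resM0 k β α)

/-! ### §3 The zero section of `ℙ¹ × 𝔸¹` lifts -/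

/-- The normal field `q ↦ t` of chart 1, written on `k[s,p]`-coordinates of the chart: `s · unitNormal`
(value `s̄` at the generator). -/
noncomputable def tNormal : idealZ k 1 →ₗ[A k] A k ⧸ idealZ k 1 := (X 0 : A k) • unitNormal k 1

/-- `tNormal (p) = s̄`. [folklore] -/
theorem tNormal_apply_X_one (h : (X 1 : A k) ∈ idealZ k 1) :
    tNormal k ⟨X 1, h⟩ = Ideal.Quotient.mk _ (X 0) := by
  rw [tNormal, LinearMap.smul_apply, unitNormal_apply_X_one]
  change Ideal.Quotient.mk (idealZ k 1) (X 0 * 1) = _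
  rw [mul_one]

/-- `resM0 α (p) = p/1` on both charts. [folklore] -/
theorem resM0_apply_X_one (α : Fin 2) : resM0 k α (X 1) = algebraMap (A k) (L k) (X 1) := by
  fin_cases α
  · rfl
  · exact resM0_one_X_one k

/-- The restriction of `tNormal` along the second chart map at the generator `p/1` is `s⁻¹`. [folklore] -/
theorem res_tNormal_apply {γ δ : Fin 2} {ρ : (A k)[ε] →+* (L k)[ε]}
    (hρ : IsThickeningHom (fstRingHom (A k)) (ε : (A k)[ε]) (fstRingHom (L k)) (ε : (L k)[ε]) ρ (resM0 k 1))
    (hP : PreservesLifts (fstRingHom (A k)) (ε : (A k)[ε]) (fstRingHom (L k)) (ε : (L k)[ε]) ρ (idealZ k 1)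
      (idealZ₂ k γ δ))
    {K₀ : Ideal (A k)[ε]} (h₀ : IsLift (fstRingHom (A k)) (ε : (A k)[ε]) (idealZ k 1) K₀)
    (hmem : algebraMap (A k) (L k) (X 1) ∈ idealZ₂ k γ δ) :
    resNormal (isFirstOrderThickening_dualNumber (A k)) (isFirstOrderThickening_dualNumber (L k)) hP h₀
        (tNormal k) ⟨algebraMap (A k) (L k) (X 1), hmem⟩ =
      Ideal.Quotient.mk (idealZ₂ k γ δ) (IsLocalization.Away.invSelf (X 0 : A k)) := by
  have hX1 : (X 1 : A k) ∈ idealZ k 1 := Ideal.subset_span rfl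
  have hmem₁ : resM0 k 1 (X 1) ∈ idealZ₂ k γ δ := by rwa [resM0_one_X_one]
  have e1 := resNormal_apply (hT := isFirstOrderThickening_dualNumber (A k))
    (hT' := isFirstOrderThickening_dualNumber (L k)) hρ hP h₀ (tNormal k) ⟨X 1, hX1⟩ (X 0)
    (tNormal_apply_X_one k hX1).symm hmem₁
  have hx : (⟨resM0 k 1 (X 1), hmem₁⟩ : idealZ₂ k γ δ) = ⟨algebraMap (A k) (L k) (X 1), hmem⟩ :=
    Subtype.ext (resM0_one_X_one k)
  rw [hx] at e1
  rw [e1, resM0_one_apply, psi0Hom_algebraMap, psi0₀_X_zero]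

/-- The restriction of `unitNormal α` along either chart map at the generator is `1`. [folklore] -/
theorem res_unitNormal_apply' {α γ δ : Fin 2} {ρ : (A k)[ε] →+* (L k)[ε]}
    (hρ : IsThickeningHom (fstRingHom (A k)) (ε : (A k)[ε]) (fstRingHom (L k)) (ε : (L k)[ε]) ρ (resM0 k α))
    (hP : PreservesLifts (fstRingHom (A k)) (ε : (A k)[ε]) (fstRingHom (L k)) (ε : (L k)[ε]) ρ (idealZ k α)
      (idealZ₂ k γ δ))
    {K₀ : Ideal (A k)[ε]} (h₀ : IsLift (fstRingHom (A k)) (ε : (A k)[ε]) (idealZ k α) K₀)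
    (hmem : algebraMap (A k) (L k) (X 1) ∈ idealZ₂ k γ δ) :
    resNormal (isFirstOrderThickening_dualNumber (A k)) (isFirstOrderThickening_dualNumber (L k)) hP h₀
        (unitNormal k α) ⟨algebraMap (A k) (L k) (X 1), hmem⟩ = 1 := by
  have hX1 : (X 1 : A k) ∈ idealZ k α := Ideal.subset_span rfl
  have hmem₁ : resM0 k α (X 1) ∈ idealZ₂ k γ δ := by rwa [resM0_apply_X_one]
  have e1 := resNormal_apply (hT := isFirstOrderThickening_dualNumber (A k))
    (hT' := isFirstOrderThickening_dualNumber (L k)) hρ hP h₀ (unitNormal k α) ⟨X 1, hX1⟩ 1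
    (unitNormal_apply_X_one k α hX1).symm hmem₁
  have hx : (⟨resM0 k α (X 1), hmem₁⟩ : idealZ₂ k γ δ) = ⟨algebraMap (A k) (L k) (X 1), hmem⟩ :=
    Subtype.ext (resM0_apply_X_one k α)
  rw [hx, map_one] at e1
  rw [e1, map_one]

/-- **THE ZERO SECTION OF `ℙ¹ × 𝔸¹` LIFTS** to the deformation glued by `t = s⁻¹`, `q = p + εt` (the twist
`s⁻¹∂/∂p` after `q ↦ p`): coboundary `φ₀ = 0`, `φ₁ = (q ↦ t)`, since `φ₁|(p) = t = s⁻¹ = θ̄(p)`.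
[cite: Hartshorne2010, §6 Thm. 6.2 (b)] -/
theorem exists_isAtlasLift_trivialBundle :
    ∃ K : Fin 2 → Ideal (A k)[ε],
      IsAtlasLift (fun _ : Fin 2 ↦ fstRingHom (A k)) (fun _ ↦ (ε : (A k)[ε])) (fun α _ ↦ mapRingHom (resM0 k α))
        (fun α β ↦ (twist (thetaFamily k α β) : (L k)[ε] →+* (L k)[ε]).comp (mapRingHom (resM0 k β)))
        (idealZ k) K := by
  have 𝔄 := thickenedAtlas_twisted (fun α _ ↦ resM0 k α) (fun _ β ↦ resM0 k β) (idealZ k) (idealZ₂ k)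
    (thetaFamily k) (preservesLifts_resM0 k) (fun α β ↦ preservesLifts_resM0 k β α)
  have hsec := isLift_map_chartSection 𝔄 (fun _ ↦ algebraMap (A k) (A k)[ε]) fun _ ↦ fstRingHom_algebraMap
  refine (exists_isAtlasLift_twisted_iff (fun α _ ↦ resM0 k α) (fun _ β ↦ resM0 k β) (idealZ k) (idealZ₂ k)
    (thetaFamily k) (preservesLifts_resM0 k) (fun α β ↦ preservesLifts_resM0 k β α)).2
    ⟨![0, tNormal k], fun α β ↦ ?_⟩
  have hmem : algebraMap (A k) (L k) (X 1) ∈ idealZ₂ k α β := Ideal.mem_map_of_mem _ (Ideal.subset_span rfl)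
  refine ext_of_span_X_one k hmem ?_
  rw [derivToNormal_apply, LinearMap.sub_apply]
  fin_cases α <;> fin_cases β
  · show Ideal.Quotient.mk _ (thetaFamily k 0 0 _) = resR 𝔄 hsec 0 0 0 _ - resL 𝔄 hsec 0 0 0 _
    rw [resR, resL, resNormal_zero (𝔄.homr 0 0) (𝔄.liftsr 0 0) (hsec 0), resNormal_zero (𝔄.homl 0 0) (𝔄.liftsl 0 0)
      (hsec 0), thetaFamily]
    simp
  · show Ideal.Quotient.mk _ (thetaFamily k 0 1 _) = resR 𝔄 hsec 0 1 (tNormal k) _ - resL 𝔄 hsec 0 1 0 _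
    rw [resR, resL, resNormal_zero (𝔄.homl 0 1) (𝔄.liftsl 0 1) (hsec 0), LinearMap.zero_apply, sub_zero,
      res_tNormal_apply k (𝔄.homr 0 1) (𝔄.liftsr 0 1) (hsec 1) hmem, thetaFamily_zero_one, theta_algebraMap_X_one]
  · show Ideal.Quotient.mk _ (thetaFamily k 1 0 _) = resR 𝔄 hsec 1 0 0 _ - resL 𝔄 hsec 1 0 (tNormal k) _
    rw [resR, resL, resNormal_zero (𝔄.homr 1 0) (𝔄.liftsr 1 0) (hsec 0), LinearMap.zero_apply, zero_sub,
      res_tNormal_apply k (𝔄.homl 1 0) (𝔄.liftsl 1 0) (hsec 1) hmem, ← map_neg, thetaFamily]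
    simp [theta_algebraMap_X_one]
  · show Ideal.Quotient.mk _ (thetaFamily k 1 1 _) = resR 𝔄 hsec 1 1 (tNormal k) _ - resL 𝔄 hsec 1 1 (tNormal k) _
    rw [resR, resL, res_tNormal_apply k (𝔄.homr 1 1) (𝔄.liftsr 1 1) (hsec 1) hmem,
      res_tNormal_apply k (𝔄.homl 1 1) (𝔄.liftsl 1 1) (hsec 1) hmem, sub_self, thetaFamily]
    simp

/-! ### §4 … but not uniquely: the constant normal field `1` is a non-zero Čech `0`-cocycle -/

/-- `1 ∉ (p)` (specialise `p ↦ 0`: `1 ≠ 0` in `k[x]`). [folklore] -/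
theorem one_not_mem_idealZ [Nontrivial k] (α : Fin 2) : (1 : A k) ∉ idealZ k α := by
  intro h
  obtain ⟨c, hc⟩ := Ideal.mem_span_singleton'.1 h
  have := congrArg (spec k) hc
  rw [map_mul, map_one, MvPolynomial.eval₂Hom_X', Matrix.cons_val_one, Matrix.cons_val_fin_one, mul_zero] at this
  exact zero_ne_one this

/-- **The constant field `1` is a Čech `0`-cocycle of the `ℙ¹ × 𝔸¹` atlas**: `unitNormal_α|_{αβ} = unitNormal_β|_{αβ}`
(both are `1` at the generator), for any base local lifts. [folklore] -/
theorem unitNormal_compatible {T : ∀ α : Fin 2, Ideal (A k)[ε]}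
    (hT : ∀ α, IsLift (fstRingHom (A k)) (ε : (A k)[ε]) (idealZ k α) (T α)) (α β : Fin 2) :
    resL (thickenedAtlas_trivialBundle k) hT α β (unitNormal k α) =
      resR (thickenedAtlas_trivialBundle k) hT α β (unitNormal k β) := by
  have 𝔄 := thickenedAtlas_trivialBundle k
  have hmem : algebraMap (A k) (L k) (X 1) ∈ idealZ₂ k α β := Ideal.mem_map_of_mem _ (Ideal.subset_span rfl)
  refine ext_of_span_X_one k hmem ?_
  rw [resL, resR, res_unitNormal_apply' k (𝔄.homl α β) (𝔄.liftsl α β) (hT α) hmem,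
    res_unitNormal_apply' k (𝔄.homr α β) (𝔄.liftsr α β) (hT β) hmem]

/-- **TWO DIFFERENT LIFTS of the zero section of `ℙ¹ × 𝔸¹`**: a lift `K` (`exists_isAtlasLift_trivialBundle`) and
its translate `K + 1` by the non-zero `0`-cocycle `1` (`…CechObstruction`, `IsAtlasLift.translate`); they differ
because `(K + 1) − K = 1 ≠ 0` (`diff_translate`, `1 ∉ (p)`).  So here the torsor of Thm. 6.2 (b) is NOT a point
(`H⁰(ℙ¹, 𝒪) = k`), in contrast with `isAtlasLift_minusOne_unique`. [cite: Hartshorne2010, §6 Thm. 6.2 (b)] -/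
theorem exists_ne_isAtlasLift_trivialBundle [Nontrivial k] :
    ∃ K K' : Fin 2 → Ideal (A k)[ε],
      IsAtlasLift (fun _ : Fin 2 ↦ fstRingHom (A k)) (fun _ ↦ (ε : (A k)[ε])) (fun α _ ↦ mapRingHom (resM0 k α))
        (fun α β ↦ (twist (thetaFamily k α β) : (L k)[ε] →+* (L k)[ε]).comp (mapRingHom (resM0 k β)))
        (idealZ k) K ∧
      IsAtlasLift (fun _ : Fin 2 ↦ fstRingHom (A k)) (fun _ ↦ (ε : (A k)[ε])) (fun α _ ↦ mapRingHom (resM0 k α))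
        (fun α β ↦ (twist (thetaFamily k α β) : (L k)[ε] →+* (L k)[ε]).comp (mapRingHom (resM0 k β)))
        (idealZ k) K' ∧ K ≠ K' := by
  obtain ⟨K, hK⟩ := exists_isAtlasLift_trivialBundle k
  have hK' := hK.translate (thickenedAtlas_trivialBundle k) hK.isLift (fun α ↦ unitNormal k α)
    (unitNormal_compatible k hK.isLift)
  refine ⟨K, _, hK, hK', fun h ↦ ?_⟩
  have hX1 : (X 1 : A k) ∈ idealZ k 0 := Ideal.subset_span rfl
  -- `(K + 1) − K = 1` on chart 0, but `K + 1 = K` would make it `K − K = 0`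
  have h1 : (hK.isLift 0).diff ((thickenedAtlas_trivialBundle k).thick 0) (hK'.isLift 0) = unitNormal k 0 :=
    diff_translate _ (hK.isLift 0) (unitNormal k 0)
  have h0 : (hK.isLift 0).diff ((thickenedAtlas_trivialBundle k).thick 0) (hK'.isLift 0) = 0 := by
    rw [IsLift.diff_congr ((thickenedAtlas_trivialBundle k).thick 0) (hK.isLift 0) (hK'.isLift 0) (hK.isLift 0)
      (hK.isLift 0) rfl (congr_fun h 0).symm]
    exact (hK.isLift 0).diff_self _
  have h2 := LinearMap.congr_fun (h1.symm.trans h0) ⟨X 1, hX1⟩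
  rw [unitNormal_apply_X_one, LinearMap.zero_apply, Ideal.Quotient.eq_zero_iff_mem] at h2
  exact one_not_mem_idealZ k 0 h2

end DoubledLine

end EmbeddedDeformation

end Summit.Ventures.HSemireg
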